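import Summits.ValiantsHypothesis.ValiantsHypothesis.Theorems.GrenetZeonDualUnipotentThreeHalvesHeavyTopCompositionBoundGeneral
import Summits.ValiantsHypothesis.ValiantsHypothesis.Theorems.GrenetZeonDualUnipotentThreeHalvesHeavyTopThreeFour
import Summits.ValiantsHypothesis.ValiantsHypothesis.Theorems.DualUnipotentThreeHalves.Negative.HeavyTopInstFifteenFortyFive
import Literature.NumberTheory.Waring.PolygonalNumberTheorem

/-!
# `GrenetZeon.DualUnipotentThreeHalves` (stmt-ValiantsHypothesis-24318), R2 `HeavyTopLaw` — census cell `(15, 21)` and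
# ★ THE CLOSED QUADRATIC BAND: `C(m,2) + n ≤ n²` ⟹ `HeavyTopInst n m` (`n ≥ 2`)

The open quadratic band `C(m,2) + n < n²` is ✓ `heavyTopInst_of_choose_two_add_lt` (kernel triviality on `K = ker N_lin`).  Its BOUNDARY
`C(m,2) + n = n²` — the formats `(3,4)`, `(15,21)`, `(85,120)`, … — is decided TRUE as well:
* at `(3,4)` by Gerstenhaber's equality case (✓ `heavyTopInst_three_four`, val-port-1 g2 / val-lit);
* at every other boundary format (`m ≥ n + 2`) by the size-general composition bound with the TRIVIAL irreducible bounds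
  (✓ `heavyTopInst_of_trivial_bounds'`): a cut `2 ≤ a ≤ m − 2` costs `≤ 2n + 1 + C(m−2,2) = n² + n − 2m + 4 < n²`, and the compositions
  `(m)`, `(1,m−1)`/`(m−1,1)`, `(1,m−2,1)` cost `n² − 1`, `n² + n − m`, `n² + 2n − 2m + 2`, all `< n²`.

* ★ `heavyTopInst_fifteen_twentyone : HeavyTopInst 15 21` — the census cell `(15,21)` (GRID v1.5: ✓ʰ by the composition ledger,
  val-idea-30 g12 / lead g4) is KERNEL, UNCONDITIONAL.
* ★ `heavyTopInst_of_choose_two_add_le` — the closed band (`2·C(n,2) + n = n²` is the tree's ✓ `Waring.PolygonalNumberTheorem.two_mul_choose_two_add`);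
  `heavyTopInst_fifteen_of_le_twentyone`, `instanceTable_n15` (row 15 as far as
  the kernel knows it: `m ≤ 21` TRUE, `m ≥ 45` FALSE by ✓ `not_heavyTopInst_fifteen_of_fortyfive_le`; `22 ≤ m ≤ 44` OPEN),
  `heavyTopInst_eightyfive_onehundredtwenty` (the next boundary format).

HONEST LABEL: instance rows of R2 decided TRUE (C₀ = 1 sliver calibration on the census side); R2 `HeavyTopLaw` (uniform constants), 24318,
S3b and `VP ≠ VNP` are untouched / NOT proved; no summit statement is proved here.  No definitions, no named facts.
[folklore bookkeeping over Theorem G + Gerstenhaber 1958 / de Seguins Pazzis 2013 via the tree; cell val-heavytop-census, eng-1 g5]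
-/

noncomputable section

-- single-conjunct layout: Sub = Summit, duplicated namespace component intended
set_option linter.dupNamespace false

namespace Summit.ValiantsHypothesis.ValiantsHypothesis.Theorems.GrenetZeon.HeavyTopCompositionBound

open Matrix
open Summit.ValiantsHypothesis.ValiantsHypothesis.Theorems.GrenetZeon.RadicalSplit

/-! ## §1 The census cell `(15, 21)` -/

/-- ★ **`HeavyTopInst 15 21`** — every affine nilpotent `21 × 21` pencil over `ℂ^{15×15}` is flag-cheap (heavy-top or not).  `C(21,2) + 15 = 225
= 15²`: the boundary of the quadratic band; decided by the size-general composition bound with trivial irreducible bounds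
(`2·15 + 1 + C(19,2) = 202`, `15 + 209`, `30 + 189`, `45 + 170`, all `< 225`).  ONE instance of R2; nothing about `HeavyTopLaw` follows.
[folklore bookkeeping over Theorem G + Gerstenhaber via the tree] -/
theorem heavyTopInst_fifteen_twentyone : HeavyTopInst 15 21 :=
  heavyTopInst_of_trivial_bounds' (by norm_num) (by decide) (by decide) (by decide) (by decide)

/-! ## §2 The closed quadratic band -/

/-- ★ **THE CLOSED QUADRATIC BAND OF R2 IS TRUE**: for `n ≥ 2` and `C(m,2) + n ≤ n²`, every affine nilpotent `m × m` pencil over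
`ℂ^{n×n}` is flag-cheap (`HeavyTopInst n m`; the heavy-top hypothesis is not used).  Interior: ✓ `heavyTopInst_of_choose_two_add_lt`;
boundary `(3,4)`: ✓ `heavyTopInst_three_four`; every other boundary format has `m ≥ n + 2` and is paid by ✓ `heavyTopInst_of_trivial_bounds'`.
Instance rows of R2 only; nothing about `HeavyTopLaw` / 24318 follows. [folklore bookkeeping over Theorem G + Gerstenhaber via the tree] -/
theorem heavyTopInst_of_choose_two_add_le {n m : ℕ} (hn : 2 ≤ n) (h : m.choose 2 + n ≤ n ^ 2) : HeavyTopInst n m := by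
  rcases h.lt_or_eq with hlt | heq
  · exact heavyTopInst_of_choose_two_add_lt (by rw [sq] at hlt; exact hlt)
  by_cases hmn : n + 2 ≤ m
  · -- a boundary format other than `(3,4)`: `m = k + 2`, `C(m,2) = C(k,2) + 2k + 1`, `C(m−1,2) = C(k,2) + k`, `C(m−2,2) = C(k,2)`
    obtain ⟨k, rfl⟩ : ∃ k, m = k + 2 := ⟨m - 2, by omega⟩
    have e0 : (k + 2).choose 2 = k.choose 2 + 1 + k * 2 := by rw [add_choose_two, Nat.choose_self]
    have e1 : (k + 2 - 1).choose 2 = k.choose 2 + k := by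
      rw [show k + 2 - 1 = k + 1 by omega, add_choose_two, show Nat.choose 1 2 = 0 by decide]; ring
    have e2 : (k + 2 - 2).choose 2 = k.choose 2 := by rw [Nat.add_sub_cancel]
    refine heavyTopInst_of_trivial_bounds' (by omega) ?_ ?_ ?_ ?_ <;> omega
  · -- `m ≤ n + 1`: the boundary equation forces `(n, m) = (3, 4)`
    have hle : m.choose 2 ≤ (n + 1).choose 2 := Nat.choose_le_choose 2 (by omega)
    have e3 : (n + 1).choose 2 = n.choose 2 + n := by
      rw [Nat.choose_succ_succ, Nat.choose_one_right, add_comm]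
    have e4 := Literature.NumberTheory.Waring.PolygonalNumberTheorem.two_mul_choose_two_add n
    have h3 : n ^ 2 ≤ 3 * n := by omega
    have hn3 : n ≤ 3 := by nlinarith
    have hm' : m ≤ n + 1 := by omega
    interval_cases n
    · exfalso
      interval_cases m <;> exact absurd heq (by decide)
    · interval_cases m
      · exact absurd heq (by decide)
      · exact absurd heq (by decide)
      · exact absurd heq (by decide)
      · exact absurd heq (by decide)
      · exact heavyTopInst_three_four

/-- **Row `n = 15`, lower part**: `HeavyTopInst 15 m` for every `m ≤ 21` (`C(m,2) + 15 ≤ 210 + 15 = 225`). [this file] -/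
theorem heavyTopInst_fifteen_of_le_twentyone {m : ℕ} (hm : m ≤ 21) : HeavyTopInst 15 m := by
  refine heavyTopInst_of_choose_two_add_le (by norm_num) ?_
  have h1 : m.choose 2 ≤ Nat.choose 21 2 := Nat.choose_le_choose 2 hm
  have h2 : Nat.choose 21 2 = 210 := by decide
  omega

/-- **Row `n = 15` of R2's instance table, as far as the kernel knows it**: `m ≤ 21` TRUE (closed band), `m ≥ 45` FALSE (the `(15,45)`
placement, ✓ `not_heavyTopInst_fifteen_of_fortyfive_le`; admissible for `C₀ = 1` iff `m ≤ 58`); `22 ≤ m ≤ 44` OPEN. [this file] -/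
theorem instanceTable_n15 : (∀ m ≤ 21, HeavyTopInst 15 m) ∧ ∀ m ≥ 45, ¬ HeavyTopInst 15 m :=
  ⟨fun _ hm => heavyTopInst_fifteen_of_le_twentyone hm, fun _ hm => not_heavyTopInst_fifteen_of_fortyfive_le hm⟩

/-- **The next boundary format `(85, 120)`** (`C(120,2) + 85 = 7140 + 85 = 7225 = 85²`): `HeavyTopInst 85 120`. [this file] -/
theorem heavyTopInst_eightyfive_onehundredtwenty : HeavyTopInst 85 120 :=
  heavyTopInst_of_choose_two_add_le (by norm_num) (by norm_num [Nat.choose_two_right])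

end Summit.ValiantsHypothesis.ValiantsHypothesis.Theorems.GrenetZeon.HeavyTopCompositionBound

end
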